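import Summits.ValiantsHypothesis.ValiantsHypothesis.Theorems.BarrierLeverReadOnceDeterminantsHitByVPMaxPlus

/-!
# Route BarrierLever — item `ReadOnceDeterminantsHitByVP` (stmt-ValiantsHypothesis-20152):
# the POLYNOMIAL-SIZE RANGE — every constant-free read-once layout with `r ≤ n^c` is hit, `b = c + 4`

Helper file (`--supports stmt-ValiantsHypothesis-20152`; cell valiant-natproofs, rung V4, 𝒟-side, prover seat
val-np-p3). Closes NO item. An UNCONDITIONAL partial range of item 20152, stated honestly: the item allows
read-once layouts of size `r ≤ C(2n,n)^a` with constants; here the layout is CONSTANT-FREE (every entry a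
coefficient variable, as in the sibling item 20239) and `r ≤ n^c` for a fixed exponent `c` (`n ≥ 8`).

**Theorem (`constantFree_readOnce_hit_of_card_le`).** For `n ≥ 8`, a read-once constant-free layout
`E : Layout n r` with `r ≤ n^c` is hit by `SmallCircuits ℂ n (c+4)`:
`∃ f, eval (coeffVector f) E.detPoly ≠ 0`. *Proof.* A max-plus certificate with `m = r` DEDICATED box product
states (`…ReadOnceMaxPlus.layout_hit_of_maxPlusCertificate`): expert `k` has box `= m_{kk}` (the exponent vector
of the diagonal entry `c_{m_{kk}}`, total degree `≤ n`) and indicator tables, so it scores `n` exactly on the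
monomial `m_{kk}` and `≤ n − 1` on every other monomial of its box; read-once makes the diagonal the unique
permutation of maximal total degree `r·n`.

WHAT THIS IS NOT: nothing for layouts with constants or of super-polynomial size (the content of item 20152);
nothing on crux 14610.
-/

-- layout Summits/ValiantsHypothesis/ValiantsHypothesis forces the duplicated namespace component
set_option linter.dupNamespace false

namespace Summit.ValiantsHypothesis.ValiantsHypothesis.Theorems.BarrierLever.ReadOnceMaxPlus

open Finset MvPolynomial Literature.Barriers.ValiantsHypothesis
open Summit.ValiantsHypothesis.ValiantsHypothesis.Theorems.BarrierLever.TorusIsolation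

variable {n r : ℕ}

/-- A dedicated score `#{t : m t = m' t}` is at most `n`. -/
theorem indicatorScore_le (m m' : Fin n →₀ ℕ) :
    (∑ t : Fin n, (if m t = m' t then 1 else 0 : ℕ)) ≤ n := by
  calc (∑ t : Fin n, (if m t = m' t then 1 else 0 : ℕ)) ≤ ∑ _t : Fin n, 1 :=
        Finset.sum_le_sum fun t _ => by split_ifs <;> simp
    _ = n := by simp

/-- A dedicated score equals `n` only on the dedicated monomial. -/
theorem eq_of_indicatorScore_eq (m m' : Fin n →₀ ℕ)
    (hk : (∑ t : Fin n, (if m t = m' t then 1 else 0 : ℕ)) = n) : m = m' := by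
  ext t
  by_contra hne
  have hlt : (∑ t : Fin n, (if m t = m' t then 1 else 0 : ℕ)) < ∑ _t : Fin n, 1 := by
    refine Finset.sum_lt_sum (fun t _ => by split_ifs <;> simp) ⟨t, mem_univ _, ?_⟩
    rw [if_neg hne]; exact Nat.zero_lt_one
  rw [hk] at hlt
  simp at hlt

/-- **The polynomial-size range of item 20152 (constant-free layouts).** For `n ≥ 8`, every read-once
layout of size `r ≤ n^c` all of whose entries are coefficient variables is hit by `SmallCircuits ℂ n (c+4)`. -/
theorem constantFree_readOnce_hit_of_card_le (c : ℕ) (hn : 8 ≤ n) (E : Layout n r)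
    (hr : r ≤ n ^ c)
    (hcf : ∀ i j, ∃ mo, E i j = Sum.inl mo)
    (hro : ∀ p q : Fin r × Fin r, ∀ mo, E p.1 p.2 = Sum.inl mo → E q.1 q.2 = Sum.inl mo → p = q) :
    ∃ f ∈ SmallCircuits ℂ n (c + 4), eval (coeffVector (degLEMonomials n) f) E.detPoly ≠ 0 := by
  classical
  -- the diagonal monomials
  choose dm hdm using fun k : Fin r => hcf k k
  -- dedicated experts: box = diagonal monomial, indicator tables
  refine layout_hit_of_maxPlusCertificate c hn E r hr (fun k t => (dm k : Fin n →₀ ℕ) t) ?_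
    (fun k t e => if e = (dm k : Fin n →₀ ℕ) t then 1 else 0) _ rfl _ rfl 1 ?_ ?_
  · -- boxes have total degree ≤ n
    intro k
    have hdeg : ((dm k : Fin n →₀ ℕ)).degree ≤ n := (dm k).2
    rwa [Finsupp.degree_eq_sum] at hdeg
  · -- the diagonal entries are usable (own box)
    intro j
    simp only [Equiv.Perm.coe_one, id_eq, hdm j, Sum.elim_inl]
    exact ⟨j, fun t => le_rfl⟩
  · -- every other permutation meets an unusable entry or has smaller total degree
    intro σ hσ
    simp only [Equiv.Perm.coe_one, id_eq]
    by_cases hall : ∀ j, Sum.elim (fun mo : degLEMonomials n => ∃ k, ∀ t, (mo : Fin n →₀ ℕ) t ≤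
        (dm k : Fin n →₀ ℕ) t) (fun z => z ≠ 0) (E (σ j) j)
    · right
      -- degrees: `n` on the diagonal, `≤ n - 1` on every other (variable) entry
      have hdeg_diag : ∀ j, Sum.elim (fun mo : degLEMonomials n =>
          (univ.filter (fun k => ∀ t, (mo : Fin n →₀ ℕ) t ≤ (dm k : Fin n →₀ ℕ) t)).sup
            (fun k => ∑ t, (if (mo : Fin n →₀ ℕ) t = (dm k : Fin n →₀ ℕ) t then 1 else 0 : ℕ)))
          (fun _ => 0) (E j j) = n := by
        intro j
        rw [hdm j, Sum.elim_inl]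
        refine le_antisymm (Finset.sup_le fun k _ => indicatorScore_le _ _) ?_
        have hmem : j ∈ univ.filter (fun k => ∀ t, (dm j : Fin n →₀ ℕ) t ≤ (dm k : Fin n →₀ ℕ) t) := by
          simp
        refine le_trans (le_of_eq ?_) (Finset.le_sup (f := fun k => ∑ t,
          (if (dm j : Fin n →₀ ℕ) t = (dm k : Fin n →₀ ℕ) t then 1 else 0 : ℕ)) hmem)
        simp
      have hdeg_le : ∀ i j, Sum.elim (fun mo : degLEMonomials n =>
          (univ.filter (fun k => ∀ t, (mo : Fin n →₀ ℕ) t ≤ (dm k : Fin n →₀ ℕ) t)).sup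
            (fun k => ∑ t, (if (mo : Fin n →₀ ℕ) t = (dm k : Fin n →₀ ℕ) t then 1 else 0 : ℕ)))
          (fun _ => 0) (E i j) ≤ n := by
        intro i j
        obtain ⟨mo, hmo⟩ := hcf i j
        rw [hmo, Sum.elim_inl]
        exact Finset.sup_le fun k _ => indicatorScore_le _ _
      obtain ⟨j₀, hj₀⟩ : ∃ j₀, σ j₀ ≠ j₀ := by
        by_contra hcon
        push Not at hcon
        exact hσ (Equiv.ext hcon)
      have hlt : Sum.elim (fun mo : degLEMonomials n =>
          (univ.filter (fun k => ∀ t, (mo : Fin n →₀ ℕ) t ≤ (dm k : Fin n →₀ ℕ) t)).sup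
            (fun k => ∑ t, (if (mo : Fin n →₀ ℕ) t = (dm k : Fin n →₀ ℕ) t then 1 else 0 : ℕ)))
          (fun _ => 0) (E (σ j₀) j₀) < n := by
        obtain ⟨mo, hmo⟩ := hcf (σ j₀) j₀
        rw [hmo, Sum.elim_inl]
        refine (Finset.sup_lt_iff (lt_of_lt_of_le (by norm_num) hn)).mpr fun k _ =>
          lt_of_le_of_ne (indicatorScore_le _ _) fun heq => ?_
        have hmk : (mo : Fin n →₀ ℕ) = (dm k : Fin n →₀ ℕ) := eq_of_indicatorScore_eq _ _ heq
        have hmk' : mo = dm k := Subtype.ext hmk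
        -- read-once: the entry `(σ j₀, j₀)` would coincide with the diagonal entry `(k, k)`
        have hpq := hro (σ j₀, j₀) (k, k) mo hmo (by rw [hmk']; exact hdm k)
        simp only [Prod.mk.injEq] at hpq
        exact hj₀ (hpq.1.trans hpq.2.symm)
      calc ∑ j, Sum.elim (fun mo : degLEMonomials n =>
            (univ.filter (fun k => ∀ t, (mo : Fin n →₀ ℕ) t ≤ (dm k : Fin n →₀ ℕ) t)).sup
              (fun k => ∑ t, (if (mo : Fin n →₀ ℕ) t = (dm k : Fin n →₀ ℕ) t then 1 else 0 : ℕ)))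
            (fun _ => 0) (E (σ j) j)
          < ∑ _j : Fin r, n := Finset.sum_lt_sum (fun j _ => hdeg_le _ _) ⟨j₀, mem_univ _, hlt⟩
        _ = _ := Finset.sum_congr rfl fun j _ => (hdeg_diag j).symm
    · left
      push Not at hall
      exact hall

end Summit.ValiantsHypothesis.ValiantsHypothesis.Theorems.BarrierLever.ReadOnceMaxPlus
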